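import Summits.SmoothPoincare4.Statement
import Literature.Topology.FourManifolds.HomotopySpheres
import Literature.Geometry.Symplectic.StandardEnd

/-!
# SmoothPoincare4 / SymplecticCap — assembly v3

Problem `SmoothPoincare4`, topic `SymplecticCap` (route SymplecticCap, positive side). Assembly
stmt-SmoothPoincare4-0519: granted (h₁) the Gromov–McDuff chart-form fact (a symplectic form on
`Σ ∖ p` standard at infinity in the chart at `p` yields a diffeomorphism `Σ ∖ p ≃ₘ ℝ⁴` agreeing
with the inverted chart near `p`; Gromov 1985 §0.3.C, McDuff 1990 Thm 1.7), (h₂) the glue crux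
stmt-SmoothPoincare4-0443 in packaged form (such a diffeomorphism extends over `p` to `Σ ≃ₘ S⁴`),
and (h₃) the route thesis stmt-SmoothPoincare4-0518 (every `Σ ∖ p` carries such a form), every
`HomotopySphere 4` is diffeomorphic to `S⁴`. Pure logic: pick a point of `Σ` (nonempty via the
homotopy equivalence with `S⁴`) and chain h₃, h₁, h₂. `SmoothPoincare4` then follows from
`Literature.SPC4.smoothPoincare4_of_forall_homotopySphere` (PIC/Reduction) with its two packaging facts.
[Gromov 1985, §0.3.C; McDuff 1990, Thm 1.7; McDuff–Salamon 2012, Thm 9.4.2]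
-/

open scoped Manifold ContDiff
open ContinuousMap

namespace Literature.SPC4

/-- Settles stmt-SmoothPoincare4-0519 (assembly v3 of route SymplecticCap): Gromov–McDuff chart
fact → glue crux (0443, packaged) → symplectic-cap thesis (0518) → every homotopy 4-sphere is
diffeomorphic to `S⁴`. [folklore] -/
theorem sympcap_assembly : (∀ (S : Literature.Topology.FourManifolds.HomotopySphere 4) (p : S.carrier) (ε : ℝ) (sf : Literature.Geometry.Kaehler.MForm (𝓡 4) (Literature.Geometry.Symplectic.punctured p) ℝ 2), Literature.Geometry.Symplectic.IsSymplecticStandardNearPoint p ε sf → ∃ Φ : (Literature.Geometry.Symplectic.punctured p) ≃ₘ⟮𝓡 4, 𝓡 4⟯ EuclideanSpace ℝ (Fin 4), Literature.Geometry.Symplectic.AgreesWithInvertedChartNear p ⇑Φ) → (∀ (S : Literature.Topology.FourManifolds.HomotopySphere 4) (p : S.carrier) (Φ : (Literature.Geometry.Symplectic.punctured p) ≃ₘ⟮𝓡 4, 𝓡 4⟯ EuclideanSpace ℝ (Fin 4)), Literature.Geometry.Symplectic.AgreesWithInvertedChartNear p ⇑Φ → Nonempty (S.carrier ≃ₘ⟮𝓡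 4, 𝓡 4⟯ Metric.sphere (0 : EuclideanSpace ℝ (Fin 5)) 1)) → (∀ (S : Literature.Topology.FourManifolds.HomotopySphere 4) (p : S.carrier), ∃ (ε : ℝ) (sf : Literature.Geometry.Kaehler.MForm (𝓡 4) (Literature.Geometry.Symplectic.punctured p) ℝ 2), Literature.Geometry.Symplectic.IsSymplecticStandardNearPoint p ε sf) → (∀ S : Literature.Topology.FourManifolds.HomotopySphere 4, Nonempty (S.carrier ≃ₘ⟮𝓡 4, 𝓡 4⟯ Metric.sphere (0 : EuclideanSpace ℝ (Fin 5)) 1)) := by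
  intro hGM hG hX S
  obtain ⟨e⟩ := S.nonempty_homotopyEquiv
  let p : S.carrier := e.invFun ⟨EuclideanSpace.single 0 1, by simp⟩
  obtain ⟨ε, sf, h⟩ := hX S p
  obtain ⟨Φ, hΦ⟩ := hGM S p ε sf h
  exact hG S p Φ hΦ

end Literature.SPC4
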